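import Summits.CriticalPhenomena.PercolationContinuityZ3.Theses.PercTreeValue
import Literature.Probability.Percolation.ConnectivityThetaSqProofs
import Literature.Probability.Percolation.ConnectivityProofs
import Literature.Probability.Percolation.TwoPointFunction
import Literature.Probability.Percolation.PercolationProofs
import HarnessLib

/-!
# Route PercTreeValue — `AssemblyViaDisjointCoexistence` (item stmt-CriticalPhenomena-7803)

`TetrahedronDisjointCoexistence → PercolationContinuityZ3`, with no mixing input: if
`θ := θ(p_c) > 0` then `τ ≥ θ²` (Grimmett 1999 §8.5, `Grimmett1999_theta_sq_le_openConn_holds`)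
makes the left side of the crux inequality `≥ δ θ⁴ > 0` for all `r ≥ r₀`, while the event
`{0 ↔ a_r, b_r ↔ c_r, 0 ↮ b_r}` is, up to the null event "two infinite open clusters"
(`Grimmett1999_numInfiniteClusters_le_one_holds`), contained in
`({0 ↔ a_r} \ {|C(0)| = ∞}) ∪ ({b_r ↔ c_r} \ {|C(b_r)| = ∞})`; both pieces have probability
tending to `0` (continuity from above of the measure along the decreasing events
"`C(0)` is finite but reaches one of the points `x_m`, `m ≥ n`", whose intersection is empty
because `m ↦ x_m` is injective; translation invariance for the second piece). Contradiction.

References: G. Grimmett, *Percolation*, 2nd ed. (1999), Thm. (8.1), §8.5; Burton–Keane 1989.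
-/

namespace Summit.CriticalPhenomena.PercolationContinuityZ3.Theorems

open MeasureTheory Filter
open Literature.Probability.Percolation Literature.Probability.LatticeModels

noncomputable section

/-- Continuity from above, real-valued form: along a decreasing sequence of measurable events with
empty intersection the probabilities tend to `0`. [folklore] -/
theorem tendsto_measureReal_of_antitone_of_iInter_eq_empty {Ω : Type*} [MeasurableSpace Ω]
    (μ : Measure Ω) [IsFiniteMeasure μ] {s : ℕ → Set Ω} (hs : ∀ n, MeasurableSet (s n))
    (hm : Antitone s) (he : (⋂ n, s n) = ∅) :
    Tendsto (fun n => μ.real (s n)) atTop (nhds 0) := by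
  have h := tendsto_measure_iInter_atTop (μ := μ) (fun n => (hs n).nullMeasurableSet) hm
    ⟨0, measure_ne_top μ _⟩
  rw [he, measure_empty] at h
  have h' := (ENNReal.tendsto_toReal ENNReal.zero_ne_top).comp h
  rw [ENNReal.toReal_zero] at h'
  exact h'

/-- The "finite cluster reaching far" events `{|C(0)| < ∞} ∩ ⋃_{m ≥ n} {0 ↔ x m}` on `ℤ³` are
decreasing in `n`, measurable, and have empty intersection when `m ↦ x m` is injective (a cluster
containing infinitely many distinct points is infinite); hence their probability tends to `0`
under any finite measure. [folklore] -/
theorem tendsto_measureReal_finite_reach (μ : Measure (BondConfig (Site 3))) [IsFiniteMeasure μ]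
    {x : ℕ → Site 3} (hx : Function.Injective x) :
    Tendsto (fun n => μ.real ((percolatesAt (0 : Site 3))ᶜ ∩
      ⋃ m, ⋃ (_ : n ≤ m), openConn (0 : Site 3) (x m))) atTop (nhds 0) := by
  refine tendsto_measureReal_of_antitone_of_iInter_eq_empty μ (fun n => ?_) ?_ ?_
  · exact (measurableSet_percolatesAt_holds (0 : Site 3)).compl.inter
      (MeasurableSet.iUnion fun m => MeasurableSet.iUnion fun _ =>
        measurableSet_openConn_holds (0 : Site 3) (x m))
  · intro n n' hnn' ω hω
    refine ⟨hω.1, ?_⟩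
    obtain ⟨m, hm, hωm⟩ := Set.mem_iUnion₂.1 hω.2
    exact Set.mem_iUnion₂.2 ⟨m, hnn'.trans hm, hωm⟩
  · ext ω
    simp only [Set.mem_iInter, Set.mem_empty_iff_false, iff_false]
    intro hω
    have hfin : ¬ (openCluster ω (0 : Site 3)).Infinite := (hω 0).1
    have hfreq : ∀ n : ℕ, ∃ m ≥ n, x m ∈ openCluster ω (0 : Site 3) := by
      intro n
      obtain ⟨m, hm, hωm⟩ := Set.mem_iUnion₂.1 (hω n).2
      exact ⟨m, hm, hωm⟩
    have hS : {m : ℕ | x m ∈ openCluster ω (0 : Site 3)}.Infinite :=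
      Nat.frequently_atTop_iff_infinite.1 (Filter.frequently_atTop.2 hfreq)
    exact hfin (Set.infinite_of_injOn_mapsTo hx.injOn (fun m hm => hm) hS)

/-- Deterministic core: with at most one infinite open cluster, two connections `0 ↔ a`, `b ↔ c`
lying in different clusters (`0 ↮ b`) force `C(0)` or `C(b)` to be finite
(`mem_openConn_of_numInfiniteClusters_le_one`). [folklore] -/
theorem mem_union_diff_percolatesAt_of_numInfiniteClusters_le_one {ω : BondConfig (Site 3)}
    (hN : numInfiniteClusters ω ≤ 1) {a b c : Site 3}
    (h : ω ∈ openConn (0 : Site 3) a ∩ openConn b c ∩ (openConn (0 : Site 3) b)ᶜ) :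
    ω ∈ (openConn (0 : Site 3) a \ percolatesAt (0 : Site 3)) ∪
      (openConn b c \ percolatesAt b) := by
  obtain ⟨⟨h0a, hbc⟩, hnb⟩ := h
  by_cases h0 : ω ∈ percolatesAt (0 : Site 3)
  · by_cases hb : ω ∈ percolatesAt b
    · exact absurd (mem_openConn_of_numInfiniteClusters_le_one hN h0 hb) hnb
    · exact Or.inr ⟨hbc, hb⟩
  · exact Or.inl ⟨h0a, h0⟩

/-- Translation invariance: `P({b ↔ c} \ {|C(b)| = ∞}) = P({0 ↔ c - b} \ {|C(0)| = ∞})` for bond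
percolation on `ℤ³` (`bondPercolation_real_preimage_shift`). [folklore] -/
theorem real_openConn_diff_percolatesAt_shift (p : unitInterval) (b c : Site 3) :
    (bondPercolation (zdGraph 3) p).real (openConn b c \ percolatesAt b) =
      (bondPercolation (zdGraph 3) p).real
        (openConn (0 : Site 3) (c - b) \ percolatesAt (0 : Site 3)) := by
  have h1 := preimage_relabel_shift_openConn b (0 : Site 3) (c - b)
  have h2 := preimage_relabel_shift_percolatesAt b (0 : Site 3)
  rw [zero_add, sub_add_cancel] at h1
  rw [zero_add] at h2
  rw [← bondPercolation_real_preimage_shift b p (openConn b c \ percolatesAt b),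
    Set.preimage_sdiff, h1, h2]

/-- **Item stmt-CriticalPhenomena-7803** (`AssemblyViaDisjointCoexistence`): disjoint coexistence
of the two opposite edges of the critical tetrahedron at a rate comparable to independence
implies `θ(p_c) = 0` on `ℤ³`. Inputs: uniqueness of the infinite cluster
(`Grimmett1999_numInfiniteClusters_le_one_holds`), `τ ≥ θ²`
(`Grimmett1999_theta_sq_le_openConn_holds`), translation invariance and continuity from above;
no mixing. [folklore] -/
theorem AssemblyViaDisjointCoexistence_proof :
    Summit.CriticalPhenomena.PercolationContinuityZ3.Theses.PercTreeValue.AssemblyViaDisjointCoexistence := by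
  unfold Theses.PercTreeValue.AssemblyViaDisjointCoexistence
  intro hD
  refine percolationContinuityZ3_iff.mpr ?_
  by_contra hne
  set θ := theta (zdGraph 3) (0 : Site 3) (criticalProbI 3) with hθdef
  have hθnn : 0 ≤ θ := by
    rw [hθdef]; unfold theta; exact measureReal_nonneg
  have hθpos : 0 < θ := lt_of_le_of_ne hθnn (Ne.symm hne)
  obtain ⟨δ, hδ, r₀, hr⟩ := hD
  set μ := bondPercolation (zdGraph 3) (criticalProbI 3) with hμ
  -- the three sequences of points and the difference vector `c_r - b_r`
  let a : ℕ → Site 3 := fun r => ![(r : ℤ), (r : ℤ), 0]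
  let b : ℕ → Site 3 := fun r => ![(r : ℤ), 0, (r : ℤ)]
  let c : ℕ → Site 3 := fun r => ![0, (r : ℤ), (r : ℤ)]
  let e : ℕ → Site 3 := fun r => c r - b r
  have ha : Function.Injective a := by
    intro m n hmn
    have := congrFun hmn 0
    simpa [a] using this
  have he : Function.Injective e := by
    intro m n hmn
    have := congrFun hmn 1
    simpa [e, b, c] using this
  -- upper bound: P(E_r) ≤ P(finite reach along a, r) + P(finite reach along e, r)
  have hupper : ∀ r : ℕ,
      μ.real (openConn (0 : Site 3) (a r) ∩ openConn (b r) (c r) ∩ (openConn (0 : Site 3) (b r))ᶜ) ≤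
        μ.real ((percolatesAt (0 : Site 3))ᶜ ∩ ⋃ m, ⋃ (_ : r ≤ m), openConn (0 : Site 3) (a m)) +
        μ.real ((percolatesAt (0 : Site 3))ᶜ ∩ ⋃ m, ⋃ (_ : r ≤ m), openConn (0 : Site 3) (e m)) := by
    intro r
    have hae : μ.real (openConn (0 : Site 3) (a r) ∩ openConn (b r) (c r) ∩
        (openConn (0 : Site 3) (b r))ᶜ) ≤
        μ.real ((openConn (0 : Site 3) (a r) \ percolatesAt (0 : Site 3)) ∪
          (openConn (b r) (c r) \ percolatesAt (b r))) := by
      simp only [measureReal_def]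
      refine ENNReal.toReal_mono (measure_ne_top _ _) (measure_mono_ae ?_)
      filter_upwards [Grimmett1999_numInfiniteClusters_le_one_holds 3 (criticalProbI 3)] with ω hω
      exact fun hωE => mem_union_diff_percolatesAt_of_numInfiniteClusters_le_one hω hωE
    refine hae.trans ((measureReal_union_le _ _).trans (add_le_add ?_ ?_))
    · refine measureReal_mono ?_
      intro ω hω
      exact ⟨hω.2, Set.mem_iUnion₂.2 ⟨r, le_rfl, hω.1⟩⟩
    · rw [hμ, real_openConn_diff_percolatesAt_shift]
      refine measureReal_mono ?_
      intro ω hω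
      exact ⟨hω.2, Set.mem_iUnion₂.2 ⟨r, le_rfl, hω.1⟩⟩
  -- lower bound: δ θ⁴ ≤ P(E_r) for r ≥ r₀
  have hlower : ∀ r : ℕ, r₀ ≤ r →
      δ * θ ^ 4 ≤ μ.real (openConn (0 : Site 3) (a r) ∩ openConn (b r) (c r) ∩
        (openConn (0 : Site 3) (b r))ᶜ) := by
    intro r hrr
    have h1 : θ ^ 2 ≤ tau 3 (criticalProbI 3) 0 (a r) :=
      Grimmett1999_theta_sq_le_openConn_holds 3 (criticalProbI 3) 0 (a r)
    have h2 : θ ^ 2 ≤ tau 3 (criticalProbI 3) (b r) (c r) :=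
      Grimmett1999_theta_sq_le_openConn_holds 3 (criticalProbI 3) (b r) (c r)
    have h12 : δ * θ ^ 4 ≤
        δ * tau 3 (criticalProbI 3) 0 (a r) * tau 3 (criticalProbI 3) (b r) (c r) := by
      have : θ ^ 4 = θ ^ 2 * θ ^ 2 := by ring
      rw [this, mul_assoc]
      exact mul_le_mul_of_nonneg_left
        (mul_le_mul h1 h2 (pow_nonneg hθnn 2) (tau_nonneg _ _ _)) hδ.le
    exact h12.trans (hr r hrr)
  -- the right side tends to 0
  have hlim : Tendsto (fun r =>
      μ.real ((percolatesAt (0 : Site 3))ᶜ ∩ ⋃ m, ⋃ (_ : r ≤ m), openConn (0 : Site 3) (a m)) +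
      μ.real ((percolatesAt (0 : Site 3))ᶜ ∩ ⋃ m, ⋃ (_ : r ≤ m), openConn (0 : Site 3) (e m)))
      atTop (nhds 0) := by
    have := (tendsto_measureReal_finite_reach μ ha).add (tendsto_measureReal_finite_reach μ he)
    rwa [add_zero] at this
  have hpos : 0 < δ * θ ^ 4 := mul_pos hδ (pow_pos hθpos 4)
  have hev : ∀ᶠ r in atTop, δ * θ ^ 4 ≤
      μ.real ((percolatesAt (0 : Site 3))ᶜ ∩ ⋃ m, ⋃ (_ : r ≤ m), openConn (0 : Site 3) (a m)) +
      μ.real ((percolatesAt (0 : Site 3))ᶜ ∩ ⋃ m, ⋃ (_ : r ≤ m), openConn (0 : Site 3) (e m)) :=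
    Filter.eventually_atTop.2 ⟨r₀, fun r hrr => (hlower r hrr).trans (hupper r)⟩
  have hle : δ * θ ^ 4 ≤ 0 := ge_of_tendsto hlim hev
  exact absurd hle (not_le.mpr hpos)

end

end Summit.CriticalPhenomena.PercolationContinuityZ3.Theorems
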